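import Summits.FinalStateConjecture.FinalStateConjecture.Theses.LaminatedThreshold
import Literature.Geometry.Lorentzian.VisibleIncompleteNullRay

/-!
# Crux `LaminatedThreshold` · line `heteroclinic_comb` RE-TYPED around the adapted comb lemma — the composition

Support file for crux item stmt-FinalStateConjecture-16893 (route LaminatedThreshold, crux A), prover seat 0,
2026-08-17. The line `Cruxes/LaminatedThreshold/Lines/heteroclinic_comb.lean` reduces the crux to three stubs;
its Stub 1 (`stub_combLemma`, the abstract comb lemma) is FALSE as typed (`Negative.stub_combLemma_false`,
seat 1: nothing ties `W^u(T)` to the `t`-axis carrying the seeds) and TRUE under the normalisation that the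
`t`-axis is `T`-invariant near `0` — registered by seat 1 as the support statement `comb_lemma_adapted`
(= `stub_combLemma` + `∀ t, |t| < r₀ → (T (0, t)).1 = 0`), whose graph-transform proof is being landed in
the `LaminatedThresholdComb*` files of both seats.

This file is the KERNEL-CHECKED COMPOSITION of the re-typed line, for the crux planner: with
* hypothesis 1 = `comb_lemma_adapted` verbatim (seat 1's registered signature),
* hypothesis 2 = `stub_vacuumCombCarrier` verbatim PLUS the one clause the adapted lemma consumes,
  `(∀ t : ℝ, |t| < r₀ → (T ((0 : E), t)).1 = 0)`, inserted after `1 < μ` (the vacuum carrier must hand over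
  the period map in coordinates ADAPTED to the naked saddle: unstable manifold straightened to the `t`-axis —
  for a `C¹` map with one unstable direction this is a `C¹` change of coordinates, so the physics content of
  Stub 2 is unchanged),
* hypothesis 3 = `stub_nakedNotSettled` verbatim,
the crux `LaminatedThreshold` follows BY NAME (`laminatedThreshold_of_adaptedComb`; the proof is that of the
line's `LaminatedThreshold_of` with the axis clause threaded from the carrier into the comb lemma). So the
re-typed line is: Stub 1 := `comb_lemma_adapted` (abstract, being closed), Stub 2 := the adapted carrier
(open-problem physics, as before), Stub 3 := `stub_nakedNotSettled` (L–XL, shared with line `birth`).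
No new definitions; hypotheses are inlined so that the statement is self-contained.
-/

-- every `Summit.FinalStateConjecture.FinalStateConjecture.…` name repeats the summit = sub-problem segment (D-0017 layout)
set_option linter.dupNamespace false

noncomputable section

open Set Filter Metric Function Topology
open scoped Manifold ContDiff
open Literature.Geometry.Lorentzian
open Summit.FinalStateConjecture.FinalStateConjecture.Theses.LaminatedThreshold

namespace Summit.FinalStateConjecture.FinalStateConjecture.Theorems.LaminatedThreshold

/-- **The crux from the re-typed comb line, verbatim form** (all three hypotheses = the registered stub texts,
the carrier with the axis clause inserted):
adapted comb lemma → adapted vacuum comb carrier → (naked developments are exceptional) → `LaminatedThreshold`.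
Carrier ↦ `(E, T, S, μ, r₀, π, d⋆)` with the axis clause; comb lemma ↦ `r₁`; carrier's seeds at scale `r₁` ↦
`(σ₁, σ₂, ε₂, G₁, G₂)` with the nakedness dictionary; comb lemma at `ε := ε₂` ↦ `(ρ, Φ, K)`; the crux's
functional is `Φ ∘ π`, its `K` is `K`; continuity along a local family = `ContinuousOn Φ (ball 0 ρ)` after
`π ∘ F`; saturation = comb trichotomy ↦ dictionary ↦ naked ↦ not good; `d⋆` exceptional from the constant
family. [cite: GrebogiEtAl1983] [cite: McdonaldEtAl1985] -/
theorem laminatedThreshold_of_adaptedComb_verbatim : (∀ (E : Type) [NormedAddCommGroup E] [NormedSpace ℝ E] [CompleteSpace E] (T : E × ℝ → E × ℝ) (S : E →L[ℝ] E) (μ r₀ : ℝ), T 0 = 0 → 0 < r₀ → ContDiffOn ℝ 1 T (Metric.ball 0 r₀) → HasFDerivAt T ((S.comp (ContinuousLinearMap.fst ℝ E ℝ)).prod (μ • ContinuousLinearMap.snd ℝ E ℝ)) 0 → ‖S‖ < 1 → 1 < μ → (∀ t : ℝ, |t| < r₀ → (T ((0 : E), t)).1 = 0) → ∃ r₁ :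 ℝ, 0 < r₁ ∧ ∀ (σ₁ σ₂ : ℝ) (G₁ G₂ : E × ℝ → ℝ), 0 < σ₁ ∧ σ₁ < r₁ ∧ -r₁ < σ₂ ∧ σ₂ < 0 ∧ (∃ r' : ℝ, 0 < r' ∧ ContDiffOn ℝ 1 G₁ (Metric.ball ((0 : E), σ₁) r') ∧ ContDiffOn ℝ 1 G₂ (Metric.ball ((0 : E), σ₂) r')) ∧ G₁ ((0 : E), σ₁) = 0 ∧ fderiv ℝ G₁ ((0 : E), σ₁) ((0 : E), (1 : ℝ)) ≠ 0 ∧ G₂ ((0 : E), σ₂) = 0 ∧ fderiv ℝ G₂ ((0 : E), σ₂) ((0 : E), (1 : ℝ)) ≠ 0 → ∀ ε : ℝ, 0 < ε → ∃ ρ : ℝ, 0 < ρ ∧ ∃ (Φ : E × ℝ → ℝ) (K : Set ℝ), Φ 0 = 0 ∧ (0 : ℝ) ∈ K ∧ (∀ η : ℝ, 0 < η → (K ∩ Set.Ioo (0 - η) 0).Nonempty ∧ (K ∩ Set.Ioo 0 (0 + η)).Nonempty) ∧ ContinuousOn Φ (Metric.ball 0 ρ) ∧ ∀ p ∈ Metric.ball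 (0 : E × ℝ) ρ, Φ p ∈ K → ((∀ n : ℕ, T^[n] p ∈ Metric.ball (0 : E × ℝ) ε) ∨ (∃ n : ℕ, T^[n] p ∈ Metric.ball ((0 : E), σ₁) ε ∧ G₁ (T^[n] p) = 0) ∨ (∃ n : ℕ, T^[n] p ∈ Metric.ball ((0 : E), σ₂) ε ∧ G₂ (T^[n] p) = 0))) → (∃ (X : Type) (_ : TopologicalSpace X) (_ : ChartedSpace Literature.Geometry.Lorentzian.E3 X) (_ : IsManifold (𝓡 3) ((⊤ : ℕ∞) : WithTop ℕ∞) X) (_ : T2Space X) (_ : SecondCountableTopology X) (_ : ConnectedSpace X) (dstar : Literature.Geometry.Lorentzian.InitialDataSet (𝓡 3) X) (E : Type) (_ : NormedAddCommGroup E) (_ : NormedSpace ℝ E) (_ : CompleteSpace E) (T : E × ℝ → E × ℝ) (S : E →L[ℝ] E) (μ r₀ : ℝ) (π : Literature.Geometry.Lorentzian.InitialDataSet (𝓡 3) X → E × ℝ), dstar ∈ Literature.Geometry.Lorentzian.admissibleVacuumData X ∧ T 0 = 0 ∧ 0 < r₀ ∧ ContDiffOn ℝ 1 T (Metric.ball 0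 r₀) ∧ HasFDerivAt T ((S.comp (ContinuousLinearMap.fst ℝ E ℝ)).prod (μ • ContinuousLinearMap.snd ℝ E ℝ)) 0 ∧ ‖S‖ < 1 ∧ 1 < μ ∧ (∀ t : ℝ, |t| < r₀ → (T ((0 : E), t)).1 = 0) ∧ π dstar = 0 ∧ (∀ F : EuclideanSpace ℝ (Fin 1) → Literature.Geometry.Lorentzian.InitialDataSet (𝓡 3) X, Literature.Geometry.Lorentzian.InitialDataSet.IsSmoothDataFamily 1 F → F 0 = dstar → (∀ c, F c ∈ Literature.Geometry.Lorentzian.admissibleVacuumData X) → (∃ C : Set X, IsCompact C ∧ ∀ c, ∀ x ∉ C, (F c).h.inner x = dstar.h.inner x ∧ (F c).k x = dstar.k x) → ∃ δ : ℝ, 0 < δ ∧ ContinuousOn (fun c ↦ π (F c)) (Metric.ball 0 δ)) ∧ ∀ r : ℝ, 0 < r → ∃ (σ₁ σ₂ ε₂ : ℝ) (G₁ G₂ : E × ℝ → ℝ), 0 < ε₂ ∧ (0 < σ₁ ∧ σ₁ < r ∧ -r < σ₂ ∧ σ₂ < 0 ∧ (∃ r' : ℝ, 0 < r' ∧ ContDiffOn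 ℝ 1 G₁ (Metric.ball ((0 : E), σ₁) r') ∧ ContDiffOn ℝ 1 G₂ (Metric.ball ((0 : E), σ₂) r')) ∧ G₁ ((0 : E), σ₁) = 0 ∧ fderiv ℝ G₁ ((0 : E), σ₁) ((0 : E), (1 : ℝ)) ≠ 0 ∧ G₂ ((0 : E), σ₂) = 0 ∧ fderiv ℝ G₂ ((0 : E), σ₂) ((0 : E), (1 : ℝ)) ≠ 0) ∧ ∀ F : EuclideanSpace ℝ (Fin 1) → Literature.Geometry.Lorentzian.InitialDataSet (𝓡 3) X, Literature.Geometry.Lorentzian.InitialDataSet.IsSmoothDataFamily 1 F → F 0 = dstar → (∀ c, F c ∈ Literature.Geometry.Lorentzian.admissibleVacuumData X) → (∃ C : Set X, IsCompact C ∧ ∀ c, ∀ x ∉ C, (F c).h.inner x = dstar.h.inner x ∧ (F c).k x = dstar.k x) → ∃ δ : ℝ, 0 < δ ∧ ∀ c ∈ Metric.ball (0 : EuclideanSpace ℝ (Fin 1)) δ, ((∀ n : ℕ, T^[n] (π (F c)) ∈ Metric.ball (0 : E × ℝ) ε₂) ∨ (∃ n : ℕ, T^[n] (π (F c)) ∈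 Metric.ball ((0 : E), σ₁) ε₂ ∧ G₁ (T^[n] (π (F c))) = 0) ∨ (∃ n : ℕ, T^[n] (π (F c)) ∈ Metric.ball ((0 : E), σ₂) ε₂ ∧ G₂ (T^[n] (π (F c))) = 0)) → ∀ 𝒟 : Literature.Geometry.Lorentzian.VacuumCauchyDevelopment (F c), 𝒟.IsMaximal → ∀ [𝒟.metric.HasLeviCivita], ∃ (γ : ℝ → 𝒟.carrier) (dom : Set ℝ), (Literature.Geometry.Lorentzian.IsMaximalGeodesicOn 𝒟.metric.leviCivita γ dom ∧ (0 : ℝ) ∈ dom ∧ BddAbove dom ∧ (∀ t ∈ dom, 𝒟.metric.IsNull (Literature.Geometry.Lorentzian.velocity (𝓡 4) γ t) ∧ 𝒟.timeOrientation.IsFutureDirected (Literature.Geometry.Lorentzian.velocity (𝓡 4) γ t)) ∧ (∀ t ∈ dom, 0 ≤ t → (∃ (p : X) (δ' : ℝ → 𝒟.carrier) (s : Set ℝ), 𝒟.metric.IsNormalisedNullRayFrom 𝒟.timeOrientation 𝒟.embed 𝒟.normal p δ' s ∧ ¬ BddAbove s ∧ γ t ∈ 𝒟.metric.chronologicalPast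 𝒟.timeOrientation (δ' '' (s ∩ Set.Ici 0)))))) → (∀ (X : Type) [TopologicalSpace X] [ChartedSpace Literature.Geometry.Lorentzian.E3 X] [IsManifold (𝓡 3) ((⊤ : ℕ∞) : WithTop ℕ∞) X] [T2Space X] [SecondCountableTopology X] [ConnectedSpace X], ∀ D ∈ Literature.Geometry.Lorentzian.admissibleVacuumData X, ∀ 𝒟 : Literature.Geometry.Lorentzian.VacuumCauchyDevelopment D, 𝒟.IsMaximal → (∀ [𝒟.metric.HasLeviCivita], ∃ (γ : ℝ → 𝒟.carrier) (dom : Set ℝ), (Literature.Geometry.Lorentzian.IsMaximalGeodesicOn 𝒟.metric.leviCivita γ dom ∧ (0 : ℝ) ∈ dom ∧ BddAbove dom ∧ (∀ t ∈ dom, 𝒟.metric.IsNull (Literature.Geometry.Lorentzian.velocity (𝓡 4) γ t) ∧ 𝒟.timeOrientation.IsFutureDirected (Literature.Geometry.Lorentzian.velocity (𝓡 4) γ t)) ∧ (∀ t ∈ dom, 0 ≤ t → (∃ (p : X) (δ' : ℝ → 𝒟.carrier) (s : Set ℝ), 𝒟.metric.IsNormalisedNullRayFrom 𝒟.timeOrientation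 𝒟.embed 𝒟.normal p δ' s ∧ ¬ BddAbove s ∧ γ t ∈ 𝒟.metric.chronologicalPast 𝒟.timeOrientation (δ' '' (s ∩ Set.Ici 0)))))) → ¬ (Summit.FinalStateConjecture.HasCompleteNullInfinity 𝒟.toCauchyDevelopment ∧ ∃ (O : Set 𝒟.carrier) (d : Literature.Geometry.Lorentzian.FinalStateDecomposition 𝒟.toSpacetime O 2), (∀ i, Literature.Geometry.Lorentzian.Kerr.IsSubextremal (d.mass i) (d.spin i)) ∧ O = Summit.FinalStateConjecture.exteriorOf 𝒟.toCauchyDevelopment d.charted ∧ Summit.FinalStateConjecture.RaysStayInClosure 𝒟.toCauchyDevelopment O ∧ Summit.FinalStateConjecture.HasExhaustiveCharts d ∧ Summit.FinalStateConjecture.IsFutureOriented d)) → Summit.FinalStateConjecture.FinalStateConjecture.Theses.LaminatedThreshold.LaminatedThreshold := by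
  intro hL hC hN
  obtain ⟨X, i₁, i₂, i₃, i₄, i₅, i₆, dstar, E, j₁, j₂, j₃, T, S, μ, r₀, π, hadm, hT0, hr₀, hT1, hTA, hS,
    hμ, haxis, hπ0, hcont, hseed⟩ := hC
  -- naked ⇒ exceptional at every admissible datum of `X` (Stub 3)
  have key : ∀ D ∈ admissibleVacuumData X,
      (∀ 𝒟 : VacuumCauchyDevelopment D, 𝒟.IsMaximal → ∀ [𝒟.metric.HasLeviCivita],
        ∃ (γ : ℝ → 𝒟.carrier) (dom : Set ℝ), (IsMaximalGeodesicOn 𝒟.metric.leviCivita γ dom ∧ (0 : ℝ) ∈ dom ∧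
          BddAbove dom ∧ (∀ t ∈ dom, 𝒟.metric.IsNull (velocity (𝓡 4) γ t) ∧
            𝒟.timeOrientation.IsFutureDirected (velocity (𝓡 4) γ t)) ∧
          (∀ t ∈ dom, 0 ≤ t → (∃ (p : X) (δ' : ℝ → 𝒟.carrier) (s : Set ℝ),
            𝒟.metric.IsNormalisedNullRayFrom 𝒟.timeOrientation 𝒟.embed 𝒟.normal p δ' s ∧ ¬ BddAbove s ∧
              γ t ∈ 𝒟.metric.chronologicalPast 𝒟.timeOrientation (δ' '' (s ∩ Set.Ici 0)))))) →
      ¬ ((∃ 𝒟 : VacuumCauchyDevelopment D, 𝒟.IsMaximal) ∧ ∀ 𝒟 : VacuumCauchyDevelopment D, 𝒟.IsMaximal →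
          Summit.FinalStateConjecture.HasCompleteNullInfinity 𝒟.toCauchyDevelopment ∧
            ∃ (O : Set 𝒟.carrier) (d : FinalStateDecomposition 𝒟.toSpacetime O 2),
              (∀ i, Kerr.IsSubextremal (d.mass i) (d.spin i)) ∧
                O = Summit.FinalStateConjecture.exteriorOf 𝒟.toCauchyDevelopment d.charted ∧
                  Summit.FinalStateConjecture.RaysStayInClosure 𝒟.toCauchyDevelopment O ∧
                    Summit.FinalStateConjecture.HasExhaustiveCharts d ∧
                      Summit.FinalStateConjecture.IsFutureOriented d) := by
    rintro D hD hnaked ⟨⟨𝒟, h𝒟⟩, hall⟩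
    exact hN X D hD 𝒟 h𝒟 (hnaked 𝒟 h𝒟) (hall 𝒟 h𝒟)
  -- the adapted comb lemma's radius for this carrier (axis clause threaded here)
  obtain ⟨r₁, hr₁, hcomb⟩ := hL E T S μ r₀ hT0 hr₀ hT1 hTA hS hμ haxis
  -- seeds on both sides at scale `r₁`, with the nakedness dictionary
  obtain ⟨σ₁, σ₂, ε₂, G₁, G₂, hε₂, hseeds, hdict⟩ := hseed r₁ hr₁
  -- the comb chart
  obtain ⟨ρ, hρ, Φ, K, hΦ0, hK0, hacc, hΦc, hsat⟩ := hcomb σ₁ σ₂ G₁ G₂ hseeds ε₂ hε₂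
  -- the family clause, with nakedness as conclusion
  have hfam : ∀ F : EuclideanSpace ℝ (Fin 1) → InitialDataSet (𝓡 3) X, InitialDataSet.IsSmoothDataFamily 1 F →
      F 0 = dstar → (∀ c, F c ∈ admissibleVacuumData X) →
      (∃ C : Set X, IsCompact C ∧ ∀ c, ∀ x ∉ C, (F c).h.inner x = dstar.h.inner x ∧ (F c).k x = dstar.k x) →
      ∃ δ : ℝ, 0 < δ ∧ ContinuousOn (fun c ↦ Φ (π (F c))) (Metric.ball 0 δ) ∧
        ∀ c ∈ Metric.ball (0 : EuclideanSpace ℝ (Fin 1)) δ, Φ (π (F c)) ∈ K →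
          ∀ 𝒟 : VacuumCauchyDevelopment (F c), 𝒟.IsMaximal → ∀ [𝒟.metric.HasLeviCivita],
            ∃ (γ : ℝ → 𝒟.carrier) (dom : Set ℝ), (IsMaximalGeodesicOn 𝒟.metric.leviCivita γ dom ∧ (0 : ℝ) ∈ dom ∧
              BddAbove dom ∧ (∀ t ∈ dom, 𝒟.metric.IsNull (velocity (𝓡 4) γ t) ∧
                𝒟.timeOrientation.IsFutureDirected (velocity (𝓡 4) γ t)) ∧
              (∀ t ∈ dom, 0 ≤ t → (∃ (p : X) (δ' : ℝ → 𝒟.carrier) (s : Set ℝ),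
                𝒟.metric.IsNormalisedNullRayFrom 𝒟.timeOrientation 𝒟.embed 𝒟.normal p δ' s ∧ ¬ BddAbove s ∧
                  γ t ∈ 𝒟.metric.chronologicalPast 𝒟.timeOrientation (δ' '' (s ∩ Set.Ici 0))))) := by
    intro F hF h0 hFadm hCpt
    obtain ⟨δ₁, hδ₁, hπc⟩ := hcont F hF h0 hFadm hCpt
    obtain ⟨δ₂, hδ₂, hnk⟩ := hdict F hF h0 hFadm hCpt
    -- `π ∘ F` is continuous at `0` and `π (F 0) = 0`, so small members are read inside `ball 0 ρ`
    have hat : ContinuousAt (fun c ↦ π (F c)) 0 :=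
      (hπc 0 (Metric.mem_ball_self hδ₁)).continuousAt (Metric.ball_mem_nhds 0 hδ₁)
    have h00 : π (F 0) = 0 := by rw [h0, hπ0]
    have hpre : (fun c ↦ π (F c)) ⁻¹' Metric.ball (0 : E × ℝ) ρ ∈ 𝓝 (0 : EuclideanSpace ℝ (Fin 1)) := by
      apply hat.preimage_mem_nhds
      rw [h00]
      exact Metric.ball_mem_nhds 0 hρ
    obtain ⟨δ₃, hδ₃, hball⟩ := Metric.mem_nhds_iff.1 hpre
    refine ⟨min δ₁ (min δ₂ δ₃), by positivity, ?_, ?_⟩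
    · have hsub₁ : Metric.ball (0 : EuclideanSpace ℝ (Fin 1)) (min δ₁ (min δ₂ δ₃)) ⊆ Metric.ball 0 δ₁ :=
        Metric.ball_subset_ball (min_le_left _ _)
      have hsub₃ : Metric.ball (0 : EuclideanSpace ℝ (Fin 1)) (min δ₁ (min δ₂ δ₃)) ⊆ Metric.ball 0 δ₃ :=
        (Metric.ball_subset_ball (min_le_right _ _)).trans (Metric.ball_subset_ball (min_le_right _ _))
      have hmaps : Set.MapsTo (fun c ↦ π (F c)) (Metric.ball (0 : EuclideanSpace ℝ (Fin 1)) (min δ₁ (min δ₂ δ₃)))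
          (Metric.ball (0 : E × ℝ) ρ) := fun c hc ↦ hball (hsub₃ hc)
      exact hΦc.comp (hπc.mono hsub₁) hmaps
    · intro c hc hK
      have hc₂ : c ∈ Metric.ball (0 : EuclideanSpace ℝ (Fin 1)) δ₂ :=
        (Metric.ball_subset_ball ((min_le_right _ _).trans (min_le_left _ _))) hc
      have hc₃ : c ∈ Metric.ball (0 : EuclideanSpace ℝ (Fin 1)) δ₃ :=
        (Metric.ball_subset_ball ((min_le_right _ _).trans (min_le_right _ _))) hc
      have hρc : π (F c) ∈ Metric.ball (0 : E × ℝ) ρ := hball hc₃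
      exact hnk c hc₂ (hsat (π (F c)) hρc hK)
  refine ⟨X, i₁, i₂, i₃, i₄, i₅, i₆, dstar, fun D ↦ Φ (π D), K, hadm, ?_, ?_, ?_, ?_⟩
  · -- `d⋆` is exceptional: saturation along the constant family through `d⋆`
    obtain ⟨δ, hδ, -, hnaked⟩ := hfam (fun _ ↦ dstar) (InitialDataSet.isSmoothDataFamily_const 1 dstar)
      rfl (fun _ ↦ hadm) ⟨∅, isCompact_empty, fun _ _ _ ↦ ⟨rfl, rfl⟩⟩
    have hmem : Φ (π dstar) ∈ K := by rw [hπ0, hΦ0]; exact hK0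
    exact key dstar hadm (hnaked 0 (Metric.mem_ball_self hδ) hmem)
  · -- `Φ d⋆ ∈ K`
    show Φ (π dstar) ∈ K
    rw [hπ0, hΦ0]; exact hK0
  · -- two-sided accumulation, transported along `Φ (π d⋆) = 0`
    intro ε hε
    show (K ∩ Set.Ioo (Φ (π dstar) - ε) (Φ (π dstar))).Nonempty ∧
      (K ∩ Set.Ioo (Φ (π dstar)) (Φ (π dstar) + ε)).Nonempty
    rw [hπ0, hΦ0]
    exact hacc ε hε
  · -- the family clause: nakedness converted into exceptionality
    intro F hF h0 hFadm hCpt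
    obtain ⟨δ, hδ, hc, hnaked⟩ := hfam F hF h0 hFadm hCpt
    exact ⟨δ, hδ, hc, fun c hcδ hcK ↦ key (F c) (hFadm c) (hnaked c hcδ hcK)⟩

/-- **The crux from the re-typed comb line** (registered support statement `laminatedThreshold_of_adaptedComb`;
the same statement with the tree's abbreviations `DataEmbedding.IsVisibleIncompleteNullRay` — Iff.rfl-equal to
the inlined naked-ray clause — and `ClusterCompleteness.SettlesT2` — the inlined settled clause): adapted comb
lemma → adapted vacuum comb carrier → (naked developments are exceptional) → `LaminatedThreshold`.
[cite: GrebogiEtAl1983] [cite: McdonaldEtAl1985] -/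
theorem laminatedThreshold_of_adaptedComb : (∀ (E : Type) [NormedAddCommGroup E] [NormedSpace ℝ E] [CompleteSpace E] (T : E × ℝ → E × ℝ) (S : E →L[ℝ] E) (μ r₀ : ℝ), T 0 = 0 → 0 < r₀ → ContDiffOn ℝ 1 T (Metric.ball 0 r₀) → HasFDerivAt T ((S.comp (ContinuousLinearMap.fst ℝ E ℝ)).prod (μ • ContinuousLinearMap.snd ℝ E ℝ)) 0 → ‖S‖ < 1 → 1 < μ → (∀ t : ℝ, |t| < r₀ → (T ((0 : E), t)).1 = 0) → ∃ r₁ : ℝ, 0 < r₁ ∧ ∀ (σ₁ σ₂ : ℝ) (G₁ G₂ : E × ℝ → ℝ), 0 < σ₁ ∧ σ₁ < r₁ ∧ -r₁ < σ₂ ∧ σ₂ < 0 ∧ (∃ r' : ℝ, 0 < r' ∧ ContDiffOn ℝ 1 G₁ (Metric.ball ((0 : E), σ₁) r') ∧ ContDiffOn ℝ 1 G₂ (Metric.ball ((0 : E), σ₂) r')) ∧ G₁ ((0 : E), σ₁) = 0 ∧ fderiv ℝ G₁ ((0 : E), σ₁) ((0 : E), (1 : ℝ)) ≠ 0 ∧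 G₂ ((0 : E), σ₂) = 0 ∧ fderiv ℝ G₂ ((0 : E), σ₂) ((0 : E), (1 : ℝ)) ≠ 0 → ∀ ε : ℝ, 0 < ε → ∃ ρ : ℝ, 0 < ρ ∧ ∃ (Φ : E × ℝ → ℝ) (K : Set ℝ), Φ 0 = 0 ∧ (0 : ℝ) ∈ K ∧ (∀ η : ℝ, 0 < η → (K ∩ Set.Ioo (0 - η) 0).Nonempty ∧ (K ∩ Set.Ioo 0 (0 + η)).Nonempty) ∧ ContinuousOn Φ (Metric.ball 0 ρ) ∧ ∀ p ∈ Metric.ball (0 : E × ℝ) ρ, Φ p ∈ K → ((∀ n : ℕ, T^[n] p ∈ Metric.ball (0 : E × ℝ) ε) ∨ (∃ n : ℕ, T^[n] p ∈ Metric.ball ((0 : E), σ₁) ε ∧ G₁ (T^[n] p) = 0) ∨ (∃ n : ℕ, T^[n] p ∈ Metric.ball ((0 : E), σ₂) ε ∧ G₂ (T^[n] p) = 0))) → (∃ (X : Type) (_ : TopologicalSpace X) (_ : ChartedSpace E3 X) (_ : IsManifold (𝓡 3) ((⊤ : ℕ∞) : WithTop ℕ∞) X) (_ : T2Space X) (_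 : SecondCountableTopology X) (_ : ConnectedSpace X) (dstar : InitialDataSet (𝓡 3) X) (E : Type) (_ : NormedAddCommGroup E) (_ : NormedSpace ℝ E) (_ : CompleteSpace E) (T : E × ℝ → E × ℝ) (S : E →L[ℝ] E) (μ r₀ : ℝ) (π : InitialDataSet (𝓡 3) X → E × ℝ), dstar ∈ admissibleVacuumData X ∧ T 0 = 0 ∧ 0 < r₀ ∧ ContDiffOn ℝ 1 T (Metric.ball 0 r₀) ∧ HasFDerivAt T ((S.comp (ContinuousLinearMap.fst ℝ E ℝ)).prod (μ • ContinuousLinearMap.snd ℝ E ℝ)) 0 ∧ ‖S‖ < 1 ∧ 1 < μ ∧ (∀ t : ℝ, |t| < r₀ → (T ((0 : E), t)).1 = 0) ∧ π dstar = 0 ∧ (∀ F : EuclideanSpace ℝ (Fin 1) → InitialDataSet (𝓡 3) X, InitialDataSet.IsSmoothDataFamily 1 F → F 0 = dstar → (∀ c, F c ∈ admissibleVacuumData X) → (∃ C : Set X, IsCompact C ∧ ∀ c, ∀ x ∉ C, (F c).h.inner x = dstar.h.inner x ∧ (F c).k x = dstar.k x) → ∃ δ : ℝ, 0 < δ ∧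 ContinuousOn (fun c ↦ π (F c)) (Metric.ball 0 δ)) ∧ ∀ r : ℝ, 0 < r → ∃ (σ₁ σ₂ ε₂ : ℝ) (G₁ G₂ : E × ℝ → ℝ), 0 < ε₂ ∧ (0 < σ₁ ∧ σ₁ < r ∧ -r < σ₂ ∧ σ₂ < 0 ∧ (∃ r' : ℝ, 0 < r' ∧ ContDiffOn ℝ 1 G₁ (Metric.ball ((0 : E), σ₁) r') ∧ ContDiffOn ℝ 1 G₂ (Metric.ball ((0 : E), σ₂) r')) ∧ G₁ ((0 : E), σ₁) = 0 ∧ fderiv ℝ G₁ ((0 : E), σ₁) ((0 : E), (1 : ℝ)) ≠ 0 ∧ G₂ ((0 : E), σ₂) = 0 ∧ fderiv ℝ G₂ ((0 : E), σ₂) ((0 : E), (1 : ℝ)) ≠ 0) ∧ ∀ F : EuclideanSpace ℝ (Fin 1) → InitialDataSet (𝓡 3) X, InitialDataSet.IsSmoothDataFamily 1 F → F 0 = dstar → (∀ c, F c ∈ admissibleVacuumData X) → (∃ C : Set X, IsCompact C ∧ ∀ c, ∀ x ∉ C, (F c).h.inner x = dstar.h.inner x ∧ (F c).k x = dstar.k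 x) → ∃ δ : ℝ, 0 < δ ∧ ∀ c ∈ Metric.ball (0 : EuclideanSpace ℝ (Fin 1)) δ, ((∀ n : ℕ, T^[n] (π (F c)) ∈ Metric.ball (0 : E × ℝ) ε₂) ∨ (∃ n : ℕ, T^[n] (π (F c)) ∈ Metric.ball ((0 : E), σ₁) ε₂ ∧ G₁ (T^[n] (π (F c))) = 0) ∨ (∃ n : ℕ, T^[n] (π (F c)) ∈ Metric.ball ((0 : E), σ₂) ε₂ ∧ G₂ (T^[n] (π (F c))) = 0)) → ∀ 𝒟 : VacuumCauchyDevelopment (F c), 𝒟.IsMaximal → ∀ [𝒟.metric.HasLeviCivita], ∃ (γ : ℝ → 𝒟.carrier) (dom : Set ℝ), 𝒟.IsVisibleIncompleteNullRay γ dom) → (∀ (X : Type) [TopologicalSpace X] [ChartedSpace E3 X] [IsManifold (𝓡 3) ((⊤ : ℕ∞) : WithTop ℕ∞) X] [T2Space X] [SecondCountableTopology X] [ConnectedSpace X], ∀ D ∈ admissibleVacuumData X, ∀ 𝒟 : VacuumCauchyDevelopment D, 𝒟.IsMaximal → (∀ [𝒟.metric.HasLeviCivita], ∃ (γ : ℝ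 → 𝒟.carrier) (dom : Set ℝ), 𝒟.IsVisibleIncompleteNullRay γ dom) → ¬ Summit.FinalStateConjecture.FinalStateConjecture.Theorems.ClusterCompleteness.SettlesT2 𝒟) → Summit.FinalStateConjecture.FinalStateConjecture.Theses.LaminatedThreshold.LaminatedThreshold :=
  fun hL hC hN ↦ laminatedThreshold_of_adaptedComb_verbatim hL hC hN

end Summit.FinalStateConjecture.FinalStateConjecture.Theorems.LaminatedThreshold

end
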